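import Literature.MathematicalPhysics.QuantumFieldTheory.Balaban1983to89.B7Prop1Rec

/-!
# `Balaban1983to89.B7Prop2Rec` — [Balaban1985Averaging] PROPOSITION 2 (52)–(54) p. 26 FOR THE RECORD's AVERAGING STRUCTURE ([Balaban1987RG1] (0.3)–(0.4)): all `k`-fold
# symmetric centred averages `avgIterZ` of a configuration in the small-field region stay `G`-valued and regular, `sup_p |Ū^k(∂p) − 1| < α₀ + 2C₀α₀²` under (52)
# `sup_p |U(∂p) − 1| < α₀η²`, with the Prop-1 constant `C₀ = 16512(d+1)²(d+4)²` of `B7Prop1Rec` — and the unitary group is closed under the record average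

statement-level skeleton of published theorems with citation tags; proofs where landed; nothing here is a claim about the Yang–Mills mass gap

CITATION HEADER (lean-in-tree rule).  Cell `pub-ymgap`, seat `pub-ymgap-dag-n05-e` g35 (N05-REC LEAD PEN); item R1 ([3] layer) of the road (director-ym №254∕№255, plan g90 SIZING
WORD); this is the `prop2Z` that n05-d's R4a (`B8Ineq130Rec`, (1.128) displayed) waits for.  `--kind definition --supports stmt-QuantumFields-20541` (K0⁷; count-neutral; the
definitions are the constant `C0Z` and the closure predicate `AvgClosedZ`, the engine's `C0`∕`AvgClosed` for the record average).  Sources READ: [3] Prop. 2 p. 26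
(`paper:balaban1985-cmp98-averaging`) through the engine module `B7Prop2Explicit` (`norm_Wcx_sub_one_le`, `step_lt`, `avgIter_mem`, `ineq53_explicit`, `prop2_explicit`,
`bavg_mem_unitaryUnits`, `avgClosed_unitaryUnits`, `prop2_unitaryUnits`), whose proofs are re-run here token for token over the record objects (`bavg ↦ bavgZ`, `avgIter ↦
avgIterZ`, `Wcx … (boxVec r) ↦ WZ … i`, `C₀ = 226·(8(d+1)(d+4))² ↦ 258·(…)²`, Prop. 1 ↦ `B7Prop1Rec.prop1_explicitZ`); [I] (0.3)–(0.4) pp. 252–253.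
WHAT IS DEFINED ∕ PROVED (sorry-free).  `AvgClosedZ L G` (closure of `G ≤ U1 𝔸` under `bavgZ` on the small loop family), `C0Z d := 258·(8(d+1)(d+4))²`, `C0Z_pos`;
`norm_WZ_sub_one_le_global` (p. 25: under (44) EVERY loop variable of (0.4) is within `2θ` of `1`, `θ = 8(d+1)(d+4)L²α₀`); `step_ltZ`, `step_avgIterZ` ((53) one step);
★`avgIterZ_mem` (all levels `G`-valued); ★`ineq53_explicitZ`; ★★★`prop2_explicitZ` ((54) + `G`-valuedness), `prop2_explicitZ_lt_two`; §5 ★`bavgZ_mem_unitaryUnits` (the exponent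
`XZ` is a real mean of skew-adjoint logarithms), `avgClosedZ_unitaryUnits`, ★★`prop2Z_unitaryUnits`.
HONEST SCOPE.  A GENUINE re-proof of [3] Prop. 2 for the typed record average; SU(N)-closure at the record's radius (the `AvgClosedAt` analogue of `B7Prop2SpecialUnitary`) is NOT
here; `HThm4Rec` UNDISCHARGED; N05 ∕ N07 NOT discharged; counts unmoved (typed 28∕28 · discharged 7∕28); one finite 𝕋⁴ programme at fixed ε — nothing continuum ∕ ℝ⁴ ∕ OS ∕
mass gap ∕ Clay.  No `instance`, no `notation`, no `sorry`.
-/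

set_option autoImplicit false

noncomputable section

open scoped BigOperators
open NormedSpace

namespace Literature.MathematicalPhysics.QuantumFieldTheory.Balaban1983to89.B7Prop2Rec

open B7Prop1Explicit hiding Site
open B7Prop1Explicit renaming Site → SiteZ
open B7Prop2Explicit (rescale rescale_apply pdev pdev_nonneg le_pdev c2' c2'_pos bound53_le hol_plaqWord_self hol_rescale_plaqWord unitaryUnits mem_unitaryUnits star_mlog_eq_neg
  unitaryUnits_le_U1 hol_mem_of)
open MatrixLog
open BlockAveragingZd (IdxZ WZ WZ_def WZ_gaugeAct XZ bavgZ avgIterZ avgIterZ_zero avgIterZ_succ)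
open B7Prop3FlatRecSide (side_estimateZ)
open B7Prop1Rec (prop1_explicitZ)

variable {d : ℕ}

section Concrete

variable {𝔸 : Type*} [NormedRing 𝔸] [NormOneClass 𝔸] [NormedAlgebra ℂ 𝔸] [CompleteSpace 𝔸]

/-- The explicit constant `C₀(d) = 258·(8(d+1)(d+4))² = 16512(d+1)²(d+4)²` of Prop. 1 (51) FOR THE RECORD AVERAGE, certified in `B7Prop1Rec.prop1_explicitZ`
(engine: `226`). [cite: Balaban1985Averaging, Prop. 1 (51) p.26; Balaban1987RG1, (0.4) p.253] -/
def C0Z (d : ℕ) : ℝ := 258 * (8 * ((d : ℝ) + 1) * (d + 4)) ^ 2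

/-- `C0Z` is positive. [cite: Balaban1985Averaging, Prop. 1 (51) p.26] -/
theorem C0Z_pos (d : ℕ) : 0 < C0Z d := by
  unfold C0Z; positivity

variable (d) in
/-- (RECORD TWIN of `B7Prop2Explicit.AvgClosed` for `bavgZ` and its loop family.) CLOSURE OF THE GAUGE GROUP UNDER THE AVERAGE (tacit in print, where `G = U(N)` and (42)–(43) are
`U(N)`-valued by (22)–(23)): a subgroup `G` of `{|u| ≤ 1, |u⁻¹| ≤ 1}` such that the one-step average (42) of a
`G`-valued configuration is `G`-valued at every `L`-bond `c` all of whose `V(Γ_{c,x})V(c)⁻¹`, `x ∈ B(c₋)`, lie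
within `1/4` of `1` (inside the domain of the series (21)).  The unitary group of any C⋆-algebra qualifies
(`avgClosed_unitaryUnits` below); this is the only property of `G` the proof of Prop. 2 needs beyond Prop. 1.
[cite: Balaban1985Averaging, (42)–(43) pp.23–24] -/
structure AvgClosedZ (L : ℕ) (G : Subgroup 𝔸ˣ) : Prop where
  le_U1 : G ≤ U1 𝔸
  bavgZ_mem : ∀ (V : SiteZ d → Fin d → 𝔸ˣ), (∀ x κ, V x κ ∈ G) → ∀ (q : SiteZ d) (κ : Fin d),
    (∀ i : IdxZ d L, ‖((WZ L V q κ i : 𝔸ˣ) : 𝔸) - 1‖ ≤ 1 / 4) → bavgZ L V q κ ∈ G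

/-! ### The smallness of `V(Γ_{c,x})V(c)⁻¹` under (44) (p. 25), for every bond of the `L`-lattice -/

/-- **p. 25, "`|V₀(Γ_{c,x}) − 1| < |Γ_{c,x}| dLα₀ < (2d+1)LdLα₀ = O(1)L²α₀`", quantified and gauge-free:** under (44)
with `512(d+1)(d+4)L²α₀ ≤ 1`, for EVERY `L`-bond `c = ⟨q, q + Le_κ⟩` of `ℤ^d` and every `x ∈ B(c₋)`,
`|V(Γ_{c,x})V(c)⁻¹ − 1| ≤ 2θ`, `θ = 8(d+1)(d+4)L²α₀` — the last clause of `B7Prop1Explicit.side_estimate` in the axial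
gauge at `y = q + 2Le_κ`, transported back by (11) (`Wcx_gaugeAct`: the loop variable is conjugated by
`u(q) ∈ {|u| ≤ 1, |u⁻¹| ≤ 1}`). [cite: Balaban1985Averaging, p.25 (displays before (47))] -/
theorem norm_WZ_sub_one_le_global (L : ℕ) (hL : 1 ≤ L) (V : SiteZ d → Fin d → 𝔸ˣ) (hV : ∀ x κ, V x κ ∈ U1 𝔸)
    {α₀ : ℝ} (hα₀ : 0 ≤ α₀) (hsmall : 512 * (d + 1) * (d + 4) * (L : ℝ) ^ 2 * α₀ ≤ 1)
    (h44 : ∀ (x : SiteZ d) (κ κ' : Fin d), κ ≠ κ' → ‖((hol V x (plaqWord κ κ') : 𝔸ˣ) : 𝔸) - 1‖ ≤ α₀)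
    (q : SiteZ d) (κ : Fin d) (i : IdxZ d L) :
    ‖((WZ L V q κ i : 𝔸ˣ) : 𝔸) - 1‖ ≤ 2 * (8 * (d + 1) * (d + 4) * (L : ℝ) ^ 2 * α₀) := by
  have hd : 1 ≤ d := κ.pos
  set y : SiteZ d := q + (L : ℤ) • e κ + (L : ℤ) • e κ with hy
  set u : SiteZ d → 𝔸ˣ := axialFn V y with hu
  set V₀ : SiteZ d → Fin d → 𝔸ˣ := gaugeAct u V with hV₀
  have huU : ∀ x, u x ∈ U1 𝔸 := fun x => axialFn_mem hV y x
  have hbond : ∀ x κ', l1 (x - y) ≤ (2 * d + 4) * L + 4 → ‖((V₀ x κ' : 𝔸ˣ) : 𝔸) - 1‖ ≤ l1 (x - y) * α₀ :=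
    fun x κ' _ => axial_bond_bound V hV y h44 hα₀ x κ'
  -- the constants, as in `B7Prop1Explicit.prop1_core`
  set R : ℕ := (2 * d + 4) * L + 4 with hRdef
  set a : ℝ := 4 * (d + 4) * L * α₀ with hadef
  set θ : ℝ := 8 * (d + 1) * (d + 4) * (L : ℝ) ^ 2 * α₀ with hθdef
  have hLr : (1 : ℝ) ≤ L := by exact_mod_cast hL
  have hdr : (1 : ℝ) ≤ d := by exact_mod_cast hd
  have ha : 0 ≤ a := by positivity
  have hθ0 : 0 ≤ θ := by positivity
  have hθ1 : θ ≤ 1 / 64 := by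
    have : 64 * θ = 512 * (d + 1) * (d + 4) * (L : ℝ) ^ 2 * α₀ := by rw [hθdef]; ring
    linarith
  have haθ : 4 * a ≤ θ := by
    have e1 : θ - 4 * a = 8 * ((d : ℝ) + 4) * L * α₀ * ((d + 1) * L - 2) := by rw [hθdef, hadef]; ring
    have e2 : 0 ≤ 8 * ((d : ℝ) + 4) * L * α₀ * ((d + 1) * L - 2) :=
      mul_nonneg (by positivity) (by nlinarith [mul_nonneg (sub_nonneg.mpr hdr) (by positivity : (0 : ℝ) ≤ L)])
    linarith
  have ha1 : a ≤ 1 := by linarith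
  have hRa : ((R : ℕ) : ℝ) * α₀ ≤ a / 2 := by
    have e1 : a / 2 - ((R : ℕ) : ℝ) * α₀ = 4 * ((L : ℝ) - 1) * α₀ := by rw [hRdef, hadef]; push_cast; ring
    have e2 : 0 ≤ 4 * ((L : ℝ) - 1) * α₀ := mul_nonneg (mul_nonneg (by norm_num) (by linarith)) hα₀
    linarith
  have hb : ∀ x κ', l1 (x - y) ≤ R → ‖((V₀ x κ' : 𝔸ˣ) : 𝔸) - 1‖ ≤ a / 2 := fun x κ' hx =>
    (hbond x κ' hx).trans ((mul_le_mul_of_nonneg_right (by exact_mod_cast hx) hα₀).trans hRa)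
  have hVA := bond_log y R ha1 hb
  have hθN : ((2 * (d * L) + L + L : ℕ) : ℝ) * a ≤ θ := le_of_eq (by rw [hadef, hθdef]; push_cast; ring)
  have hRexp : R = 2 * (d * L) + 4 * L + 4 := by rw [hRdef]; ring
  have hqy : l1 (q - y) ≤ 2 * L := by
    rw [hy, show q - (q + (L : ℤ) • e κ + (L : ℤ) • e κ) = -((L : ℤ) • e κ + (L : ℤ) • e κ) by abel, l1_neg]
    refine (l1_add_le _ _).trans ?_
    rw [l1_zsmul_e, Int.natAbs_natCast]; omega
  have hside := side_estimateZ V₀ (fun x κ' => MatrixLog.mlog ((V₀ x κ' : 𝔸ˣ) : 𝔸)) y R ha hVA L hL q κ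
    (by rw [hRexp]; omega) hθN hθ0 hθ1
  have hW₀ := hside.2.2.2.2 i
  -- back to `V` by (11): `V₀(Γ_{c,x})V₀(c)⁻¹ = u(q) · V(Γ_{c,x})V(c)⁻¹ · u(q)⁻¹`
  refine (norm_sub_one_le_of_conj (X := WZ L V q κ i) (huU q)).trans ?_
  rw [← WZ_gaugeAct]
  exact hW₀

/-! ### One step of (53): Proposition 1 at level `j`, for all plaquettes of the next lattice -/

/-- **The induction step of (53)** (p. 26: (53) "by induction" from (51)): if a configuration `W` with values in
`G ⊂ {|u| ≤ 1, |u⁻¹| ≤ 1}` has `sup_p |W(∂p) − 1| < P ≤ c₂′`, then its rescaled one-step average has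
`sup_{p′} |W̄(∂p′) − 1| < L²P + C₀(L²P)²` — Prop. 1 (`B7Prop1Explicit.prop1_explicit`) at every plaquette
`p′` of the `L`-lattice (the degenerate words `μ = ν` contribute `0`), then the supremum. [cite: Balaban1985Averaging, (51)–(53) p.26] -/
theorem step_ltZ (L : ℕ) (hL : 1 ≤ L) {G : Subgroup 𝔸ˣ} (hGU : G ≤ U1 𝔸) (W : SiteZ d → Fin d → 𝔸ˣ)
    (hW : ∀ x κ, W x κ ∈ G) {P : ℝ} (hPc : P ≤ c2' d L) (hWP : pdev W < P) :
    pdev (rescale L (bavgZ L W)) < (L : ℝ) ^ 2 * P + C0Z d * ((L : ℝ) ^ 2 * P) ^ 2 := by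
  have hU : ∀ x κ, W x κ ∈ U1 𝔸 := fun x κ => hGU (hW x κ)
  have hLr : (1 : ℝ) ≤ L := by exact_mod_cast hL
  set α := pdev W with hαdef
  have hα0 : 0 ≤ α := pdev_nonneg W
  have hpos : (0 : ℝ) < 512 * ((d : ℝ) + 1) * (d + 4) * (L : ℝ) ^ 2 := by positivity
  have hsmall : 512 * (d + 1) * (d + 4) * (L : ℝ) ^ 2 * α ≤ 1 := by
    have h1 : α ≤ 1 / (512 * ((d : ℝ) + 1) * (d + 4) * (L : ℝ) ^ 2) := hWP.le.trans hPc
    rw [le_div_iff₀ hpos] at h1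
    linarith
  have h44 : ∀ (x : SiteZ d) (κ κ' : Fin d), κ ≠ κ' → ‖((hol W x (plaqWord κ κ') : 𝔸ˣ) : 𝔸) - 1‖ ≤ α :=
    fun x κ κ' _ => le_pdev hU x κ κ'
  have hB0 : 0 ≤ (L : ℝ) ^ 2 * α + 258 * (8 * (d + 1) * (d + 4) * (L : ℝ) ^ 2 * α) ^ 2 := by positivity
  have hle : pdev (rescale L (bavgZ L W))
      ≤ (L : ℝ) ^ 2 * α + 258 * (8 * (d + 1) * (d + 4) * (L : ℝ) ^ 2 * α) ^ 2 := by
    refine Real.iSup_le (fun p => ?_) hB0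
    obtain ⟨z, μ, ν⟩ := p
    dsimp only
    by_cases hμν : μ = ν
    · subst hμν
      rw [hol_plaqWord_self, Units.val_one, sub_self, norm_zero]
      exact hB0
    · rw [hol_rescale_plaqWord]
      exact prop1_explicitZ L hL ((L : ℤ) • z) hμν W hU hα0 hsmall h44
  refine hle.trans_lt ?_
  have hL2 : (0 : ℝ) < (L : ℝ) ^ 2 := by positivity
  have h1 : (L : ℝ) ^ 2 * α < (L : ℝ) ^ 2 * P := by gcongr
  have h2 : (8 * ((d : ℝ) + 1) * (d + 4) * (L : ℝ) ^ 2 * α) ^ 2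
      ≤ (8 * ((d : ℝ) + 1) * (d + 4) * (L : ℝ) ^ 2 * P) ^ 2 := by
    gcongr
  have hC : C0Z d * ((L : ℝ) ^ 2 * P) ^ 2 = 258 * (8 * ((d : ℝ) + 1) * (d + 4) * (L : ℝ) ^ 2 * P) ^ 2 := by
    unfold C0Z; ring
  rw [hC]
  linarith

/-- `step_lt` for the iterate: the hypothesis `step` of `B7.ineq53_induction` at level `j`, PROVIDED `Ū^j` is
`G`-valued. [cite: Balaban1985Averaging, (53) p.26] -/
theorem step_avgIterZ (L : ℕ) (hL : 1 ≤ L) {G : Subgroup 𝔸ˣ} (hGU : G ≤ U1 𝔸) (V : SiteZ d → Fin d → 𝔸ˣ)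
    (j : ℕ) (hj : ∀ x κ, avgIterZ L V j x κ ∈ G) (P : ℝ) (_hP : 0 < P) (hPc : P ≤ c2' d L)
    (hjP : pdev (avgIterZ L V j) < P) :
    pdev (avgIterZ L V (j + 1)) < (L : ℝ) ^ 2 * P + C0Z d * ((L : ℝ) ^ 2 * P) ^ 2 :=
  step_ltZ L hL hGU _ hj hPc hjP

/-! ### Proposition 2: all levels stay in the small-field region, and (53), (54) -/

/-- **The `G`-valuedness of all `Ū^j`, `j ≤ k`** (tacit in print): under (52) and `α₀ ≤ c₂`, by induction on `j`,
using (53) at level `j` (`B7.ineq53_induction` applied with `k := j`) to see that `Ū^j` satisfies (44) with a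
constant `< 2α₀ ≤ c₂′`, hence (`norm_Wcx_sub_one_le`) all `Ū^j(Γ_{c,x})Ū^j(c)⁻¹` lie within `1/32` of `1`, and
the closure property `AvgClosed`. [cite: Balaban1985Averaging, (52)–(53) p.26] -/
theorem avgIterZ_mem (L : ℕ) (hL : 2 ≤ L) {G : Subgroup 𝔸ˣ} (hG : AvgClosedZ d L G) (k : ℕ)
    (V : SiteZ d → Fin d → 𝔸ˣ) (hV : ∀ x κ, V x κ ∈ G) {α₀ : ℝ} (hα : 0 < α₀)
    (hα3 : C0Z d * α₀ ≤ 1 / 3) (hα2 : 2 * α₀ ≤ c2' d L)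
    (h52 : pdev V < α₀ * (((L : ℝ) ^ k)⁻¹) ^ 2) :
    ∀ j ≤ k, ∀ x κ, avgIterZ L V j x κ ∈ G := by
  have hL1 : 1 ≤ L := le_trans (by norm_num) hL
  have hLr : (2 : ℝ) ≤ L := by exact_mod_cast hL
  have hL1r : (1 : ℝ) ≤ L := by linarith
  have hC := C0Z_pos d
  set η : ℝ := ((L : ℝ) ^ k)⁻¹ with hη
  have hη0 : 0 < η := by positivity
  set a : ℕ → ℝ := fun j => pdev (avgIterZ L V j) with hadef
  have h52' : a 0 < α₀ * η ^ 2 := h52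
  have hr0 : 0 ≤ (1 + C0Z d * α₀) ^ 2 / (L : ℝ) ^ 2 := by positivity
  have hrhalf : (1 + C0Z d * α₀) ^ 2 / (L : ℝ) ^ 2 ≤ 1 / 2 :=
    (B7.prop2_ratio_lt_half (C0Z d) α₀ L hLr (mul_nonneg hC.le hα.le) hα3).le
  -- induction on the level, carrying the `G`-valuedness of ALL lower levels
  suffices H : ∀ j, j ≤ k → ∀ i ≤ j, ∀ x κ, avgIterZ L V i x κ ∈ G from fun j hj => H j hj j le_rfl
  intro j
  induction j with
  | zero =>
      intro _ i hi
      obtain rfl : i = 0 := Nat.le_zero.mp hi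
      simpa using hV
  | succ j ih =>
      intro hjk i hi
      have hjk' : j ≤ k := Nat.le_of_succ_le hjk
      have ihj := ih hjk'
      rcases Nat.lt_or_eq_of_le hi with hlt | rfl
      · exact ihj i (Nat.lt_succ_iff.mp hlt)
      -- the new level `j + 1`: first (53) at level `j`
      have hstep : ∀ i < j, ∀ P : ℝ, 0 < P → P ≤ c2' d L → a i < P →
          a (i + 1) < (L : ℝ) ^ 2 * P + C0Z d * ((L : ℝ) ^ 2 * P) ^ 2 :=
        fun i hi P hP hPc hiP => step_avgIterZ L hL1 hG.le_U1 V i (ihj i hi.le) P hP hPc hiP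
      have hηj : (L : ℝ) ^ j * η ≤ 1 := by
        rw [hη, ← div_eq_mul_inv, div_le_one (by positivity)]
        exact pow_le_pow_right₀ hL1r hjk'
      have h53 := B7.ineq53_induction (L : ℝ) η α₀ (C0Z d) (c2' d L) j a hLr hη0 hηj (C0Z_pos d) hα hα3 hα2
        h52' hstep j le_rfl
      have hS0 : 0 ≤ ∑ i ∈ Finset.range j, ((1 + C0Z d * α₀) ^ 2 / (L : ℝ) ^ 2) ^ i :=
        Finset.sum_nonneg fun i _ => pow_nonneg hr0 i
      have hS2 := B7.geom_bracket_le_two _ hr0 hrhalf j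
      have hbound : a j < α₀ + 2 * C0Z d * α₀ ^ 2 :=
        h53.trans_le (bound53_le (C0Z_pos d).le hα.le (by positivity) hηj hS0 hS2)
      have htwo := B7.prop2_bound_lt_two_alpha (C0Z d) α₀ hα hα3
      -- so `Ū^j` satisfies (44) with `α := a j < 2α₀ ≤ c₂′`
      have hU : ∀ x κ, avgIterZ L V j x κ ∈ U1 𝔸 := fun x κ => hG.le_U1 (ihj j le_rfl x κ)
      have hαj0 : 0 ≤ a j := pdev_nonneg _
      have hpos : (0 : ℝ) < 512 * ((d : ℝ) + 1) * (d + 4) * (L : ℝ) ^ 2 := by positivity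
      have hsmall : 512 * (d + 1) * (d + 4) * (L : ℝ) ^ 2 * a j ≤ 1 := by
        have h1 : a j ≤ 1 / (512 * ((d : ℝ) + 1) * (d + 4) * (L : ℝ) ^ 2) := by
          have : a j ≤ c2' d L := by linarith
          exact this
        rw [le_div_iff₀ hpos] at h1
        linarith
      have h44 : ∀ (x : SiteZ d) (κ κ' : Fin d), κ ≠ κ' →
          ‖((hol (avgIterZ L V j) x (plaqWord κ κ') : 𝔸ˣ) : 𝔸) - 1‖ ≤ a j :=
        fun x κ κ' _ => le_pdev hU x κ κ'
      have hWcx : ∀ (q : SiteZ d) (κ : Fin d) (i : IdxZ d L),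
          ‖((WZ L (avgIterZ L V j) q κ i : 𝔸ˣ) : 𝔸) - 1‖ ≤ 1 / 4 := by
        intro q κ i
        refine (norm_WZ_sub_one_le_global L hL1 _ hU hαj0 hsmall h44 q κ i).trans ?_
        have : 2 * (8 * ((d : ℝ) + 1) * (d + 4) * (L : ℝ) ^ 2 * a j)
            = (512 * ((d : ℝ) + 1) * (d + 4) * (L : ℝ) ^ 2 * a j) / 32 := by ring
        rw [this]
        linarith
      intro x κ
      rw [BlockAveragingZd.avgIterZ_succ, rescale_apply]
      exact hG.bavgZ_mem _ (ihj j le_rfl) _ κ (hWcx _ κ)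

/-- **(53) p. 26 for the concrete `k`-fold average (43), kernel-checked:** under (52)
`sup_p |U(∂p) − 1| < α₀η²`, `η = L^{−k}`, and `α₀ ≤ c₂ = min{1/(3C₀), ½c₂′}` (as `C₀α₀ ≤ ⅓`, `2α₀ ≤ c₂′`), for all
`j ≤ k`: `sup_{p ⊂ Ω^{(j)}} |Ū^j(∂p) − 1| < α₀(L^jη)² + C₀(α₀(L^jη)²)²·[1 + L^{−2}(1+C₀α₀)² + … +
(L^{−2}(1+C₀α₀)²)^{j−1}]` — `B7.ineq53_induction` with its `step` discharged by Prop. 1 at every level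
(`step_avgIter`, `avgIter_mem`). [cite: Balaban1985Averaging, (53) p.26] -/
theorem ineq53_explicitZ (L : ℕ) (hL : 2 ≤ L) {G : Subgroup 𝔸ˣ} (hG : AvgClosedZ d L G) (k : ℕ)
    (V : SiteZ d → Fin d → 𝔸ˣ) (hV : ∀ x κ, V x κ ∈ G) {α₀ : ℝ} (hα : 0 < α₀)
    (hα3 : C0Z d * α₀ ≤ 1 / 3) (hα2 : 2 * α₀ ≤ c2' d L)
    (h52 : pdev V < α₀ * (((L : ℝ) ^ k)⁻¹) ^ 2) :
    ∀ j ≤ k, pdev (avgIterZ L V j) < α₀ * ((L : ℝ) ^ j * ((L : ℝ) ^ k)⁻¹) ^ 2 +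
      C0Z d * (α₀ * ((L : ℝ) ^ j * ((L : ℝ) ^ k)⁻¹) ^ 2) ^ 2 *
        ∑ i ∈ Finset.range j, ((1 + C0Z d * α₀) ^ 2 / (L : ℝ) ^ 2) ^ i := by
  have hL1 : 1 ≤ L := le_trans (by norm_num) hL
  have hLr : (2 : ℝ) ≤ L := by exact_mod_cast hL
  have hL1r : (1 : ℝ) ≤ L := by linarith
  have hmem := avgIterZ_mem L hL hG k V hV hα hα3 hα2 h52
  have hηk : (L : ℝ) ^ k * ((L : ℝ) ^ k)⁻¹ ≤ 1 := by
    rw [mul_inv_cancel₀ (by positivity)]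
  exact B7.ineq53_induction (L : ℝ) _ α₀ (C0Z d) (c2' d L) k (fun j => pdev (avgIterZ L V j)) hLr
    (by positivity) hηk (C0Z_pos d) hα hα3 hα2 h52
    (fun j hj P hP hPc hjP => step_avgIterZ L hL1 hG.le_U1 V j (hmem j hj.le) P hP hPc hjP)

/-- **Proposition 2 (54) p. 26 for the concrete `k`-fold average (43), kernel-checked with explicit constants,
uniformly in `k`:** "If `U` satisfies (52) with `α₀ ≤ c₂ = min{1/(3C₀), ½c₂′}`, then `|Ū^k(∂p) − 1| < α₀ + 2C₀α₀²
< 2α₀`, `p ⊂ Ω^{(k)}` (54)."  Here: `U` a configuration on `ℤ^d` (`L ≥ 2`) with values in an `AvgClosed`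
group `G` (e.g. the unitary group of a C⋆-algebra, `prop2_unitaryUnits`), read on the unit lattice, with
`sup_p |U(∂p) − 1| < α₀η²`, `η = L^{−k}`; conclusion `sup_{p ⊂ Ω^{(k)}} |Ū^k(∂p) − 1| < α₀ + 2C₀α₀²` with
`C₀ = 14464(d+1)²(d+4)²`, `c₂′ = 1/(512(d+1)(d+4)L²)`; and every `Ū^j`, `j ≤ k`, is `G`-valued.  Proof = the printed
one: (53) by induction from Prop. 1, "taking `j = k`" (`B7.prop2_of_ineq53`). [cite: Balaban1985Averaging, Prop. 2 (52)–(54) p.26] -/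
theorem prop2_explicitZ (L : ℕ) (hL : 2 ≤ L) {G : Subgroup 𝔸ˣ} (hG : AvgClosedZ d L G) (k : ℕ)
    (V : SiteZ d → Fin d → 𝔸ˣ) (hV : ∀ x κ, V x κ ∈ G) {α₀ : ℝ} (hα : 0 < α₀)
    (hα3 : C0Z d * α₀ ≤ 1 / 3) (hα2 : 2 * α₀ ≤ c2' d L)
    (h52 : pdev V < α₀ * (((L : ℝ) ^ k)⁻¹) ^ 2) :
    pdev (avgIterZ L V k) < α₀ + 2 * C0Z d * α₀ ^ 2 ∧ ∀ j ≤ k, ∀ x κ, avgIterZ L V j x κ ∈ G := by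
  have hL1 : 1 ≤ L := le_trans (by norm_num) hL
  have hLr : (2 : ℝ) ≤ L := by exact_mod_cast hL
  have hmem := avgIterZ_mem L hL hG k V hV hα hα3 hα2 h52
  refine ⟨?_, hmem⟩
  have hηk : (L : ℝ) ^ k * ((L : ℝ) ^ k)⁻¹ = 1 := mul_inv_cancel₀ (by positivity)
  exact B7.prop2_of_ineq53 (L : ℝ) _ α₀ (C0Z d) (c2' d L) k (fun j => pdev (avgIterZ L V j)) hLr
    (by positivity) hηk (C0Z_pos d) hα hα3 hα2 h52
    (fun j hj P hP hPc hjP => step_avgIterZ L hL1 hG.le_U1 V j (hmem j hj.le) P hP hPc hjP)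

/-- The last inequality of (54): the bound is `< 2α₀` (so `Ū^k` again satisfies a hypothesis of type (44)/(52) —
"uniformly in `k`"). [cite: Balaban1985Averaging, Prop. 2 (54) p.26] -/
theorem prop2_explicitZ_lt_two (L : ℕ) (hL : 2 ≤ L) {G : Subgroup 𝔸ˣ} (hG : AvgClosedZ d L G)
    (k : ℕ) (V : SiteZ d → Fin d → 𝔸ˣ) (hV : ∀ x κ, V x κ ∈ G) {α₀ : ℝ} (hα : 0 < α₀)
    (hα3 : C0Z d * α₀ ≤ 1 / 3) (hα2 : 2 * α₀ ≤ c2' d L)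
    (h52 : pdev V < α₀ * (((L : ℝ) ^ k)⁻¹) ^ 2) :
    pdev (avgIterZ L V k) < 2 * α₀ :=
  (prop2_explicitZ L hL hG k V hV hα hα3 hα2 h52).1.trans (B7.prop2_bound_lt_two_alpha (C0Z d) α₀ hα hα3)


end Concrete

/-! ## §5 The unitary group is closed under the record average ([3] (22)–(23): `log U = iA`, `A` hermitian) -/

section Unitary

variable {𝔸 : Type*} [CStarAlgebra 𝔸]

/-- (RECORD TWIN of `B7Prop2Explicit.bavg_mem_unitaryUnits`: the loop family of (0.4).) **The average (0.4) of a `U(N)`-valued configuration is `U(N)`-valued** (tacit in print; it is what makes (43)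
iterable): if every `V(Γ_{c,x})V(c)⁻¹`, `x ∈ B(c₋)`, lies within `1/4` of `1`, the exponent
`X_c = Σ_x L^{−d} log[V(Γ_{c,x})V(c)⁻¹]` is skew-adjoint (a real combination of skew-adjoint elements), so `e^{X_c}` is
unitary (Mathlib `NormedSpace.exp_mem_unitary_of_mem_skewAdjoint`) and `V̄_c = e^{X_c} V(c)` is unitary. [cite: Balaban1985Averaging, (42) p.23, (22)–(23) p.21] -/
theorem bavgZ_mem_unitaryUnits {V : SiteZ d → Fin d → 𝔸ˣ} (hV : ∀ x κ, V x κ ∈ unitaryUnits 𝔸) (L : ℕ)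
    (q : SiteZ d) (κ : Fin d)
    (hW : ∀ i : IdxZ d L, ‖((WZ L V q κ i : 𝔸ˣ) : 𝔸) - 1‖ ≤ 1 / 4) :
    bavgZ L V q κ ∈ unitaryUnits 𝔸 := by
  have hWm : ∀ i : IdxZ d L, ((WZ L V q κ i : 𝔸ˣ) : 𝔸) ∈ unitary 𝔸 := fun i => hol_mem_of hV _ _
  have hX : XZ L V q κ ∈ skewAdjoint 𝔸 := by
    unfold XZ
    refine sum_mem fun i _ => skewAdjoint.smul_mem _ ?_
    rw [skewAdjoint.mem_iff]
    exact star_mlog_eq_neg (hWm i) (hW i)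
  letI : NormedAlgebra ℚ 𝔸 := NormedAlgebra.restrictScalars ℚ ℂ 𝔸
  have hexp : exp (XZ L V q κ) ∈ unitary 𝔸 := NormedSpace.exp_mem_unitary_of_mem_skewAdjoint hX
  show exp (XZ L V q κ) * ((hol V q (seg κ L) : 𝔸ˣ) : 𝔸) ∈ unitary 𝔸
  exact Submonoid.mul_mem _ hexp (hol_mem_of hV _ _)

variable [Nontrivial 𝔸]

variable (d) in
/-- **The unitary group of a C⋆-algebra is an admissible gauge group for Prop. 2** (`AvgClosed`): it lies in
`{|u| ≤ 1, |u⁻¹| ≤ 1}` and is closed under the average (42). [cite: Balaban1985Averaging, (42)–(43) pp.23–24] -/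
theorem avgClosedZ_unitaryUnits (L : ℕ) : AvgClosedZ d L (unitaryUnits 𝔸) :=
  ⟨unitaryUnits_le_U1, fun _ hV q κ hW => bavgZ_mem_unitaryUnits hV _ q κ hW⟩

/-- **Proposition 2 (54) for `U(N)`-type gauge groups:** `prop2_explicit` for configurations with values in the
unitary group of a C⋆-algebra (`M_N(ℂ)` with the operator norm (19) and `G = U(N)` included). [cite: Balaban1985Averaging, Prop. 2 (52)–(54) p.26] -/
theorem prop2Z_unitaryUnits (L : ℕ) (hL : 2 ≤ L) (k : ℕ) (V : SiteZ d → Fin d → 𝔸ˣ)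
    (hV : ∀ x κ, V x κ ∈ unitaryUnits 𝔸) {α₀ : ℝ} (hα : 0 < α₀) (hα3 : C0Z d * α₀ ≤ 1 / 3)
    (hα2 : 2 * α₀ ≤ c2' d L) (h52 : pdev V < α₀ * (((L : ℝ) ^ k)⁻¹) ^ 2) :
    pdev (avgIterZ L V k) < α₀ + 2 * C0Z d * α₀ ^ 2 ∧ ∀ j ≤ k, ∀ x κ, avgIterZ L V j x κ ∈ unitaryUnits 𝔸 :=
  prop2_explicitZ L hL (avgClosedZ_unitaryUnits d L) k V hV hα hα3 hα2 h52

end Unitary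

end Literature.MathematicalPhysics.QuantumFieldTheory.Balaban1983to89.B7Prop2Rec
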